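import Summits.NavierStokesRegularity.NavierStokesRegularity.Theorems.ForcedAmplifierBlowupAlternativeNormalisation
import Literature.Analysis.FunctionSpaces.TorusLerayHelmholtzSpaceTime
import Summits.NavierStokesRegularity.NavierStokesRegularity.Theses.ForcedAmplifier
import HarnessLib

/-!
# Route `ForcedAmplifier`, aside `BlowupAlternative` (item stmt-NavierStokesRegularity-28106) — PROVED

`BlowupAlternative` (the exactness certificate of the node `D♯ ⟸ AMP ∧ QuantitativeGap ∧ Bridge`: it is what
makes the residual `AMP` a CONSEQUENCE of the target, `D♯ → AMP`): for every `ν > 0`, if Tao's Conjecture 1.8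
(torus form: global smooth solutions for all smooth divergence-free data and all forces jointly smooth on
`[0,∞) × 𝕋³`) FAILS at viscosity `ν`, then smooth forced episodes of one data size and horizon reach
arbitrarily large `H¹` norm (the `ν`-slice of `AMP`, i.e. the negation of Tao's Conjecture 1.10 at `ν`).

Proof.  `solution_of_normalised_solution` (FORCE NORMALISATION): for a smooth divergence-free datum `u₀` and a
force `f` jointly smooth on `[0,∞) × 𝕋³` there are a MEAN-ZERO datum `w₀ = u₀ - ∫u₀` and a field `ū`, jointly
smooth on `[0,∞) × 𝕋³` with divergence-free mean-zero slices, such that every classical solution of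
NS_ν(∂ₜū) on `[0,T]` from `w₀` yields one of NS_ν(f) from `u₀`: Seeley-extend `f` to all times
(`exists_smooth_extension`), Leray–Helmholtz-project it in space–time (`Torus.smooth_leray_helmholtz_holds`:
`f = w₁ + ∇φ` on `[0,T]`), subtract the spatial mean `m(t)` of `w₁`, pass to the accelerated Galilean frame
`ξ(t) = -∫₀ᵗ (∫u₀ + ∫₀ˢ m)` (`IsClassicalNSSolutionOn.galileanBoost` on the periodic lift, `of_torus_holds` /
`to_torus_holds`), present the normalised force `h(t, · - ξ(t))`, `h := w₁ - m`, as the one-sided time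
derivative of its time primitive (tools II), and undo frame and gauge (`gauge_congr`; physical pressure
`p = q ∘ frame + φ`, the frame's inertial term `⟪ξ'', y⟫` cancelled by the mean force `m = -ξ''`).  Then
`blowupAlternative_proof` combines it with the PDE core `amplification_of_noncontinuable` (tools I) on the
normalised class.

Main result: `blowupAlternative_proof : Theses.ForcedAmplifier.BlowupAlternative` (the item, by name).
Def-free; no `sorry`; axioms ⊆ {propext, Classical.choice, Quot.sound}.
Sources: [ConstantinFoias1988] Ch. 10; [Tao2013Localisation] arXiv:1108.1165 §1 (Conj. 1.8, 1.10, Remark 1.11), Thm 5.1;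
[RobinsonRodrigoSadowskiCUP2016] §8.1; [MajdaBertozzi2002] §1.2.  Lens provenance: decomp-ns lens 4,
generation 26 (HOME/decomp-ns-lens-4/NODE-g26.md; lens file ForcedAmplifierAlternative.lean sha256 969ae0e8…).
-/

set_option linter.dupNamespace false

noncomputable section

open Set Function Filter MeasureTheory
open scoped ContDiff Topology Pointwise RealInnerProductSpace

namespace Summit.NavierStokesRegularity.NavierStokesRegularity.Theorems.ForcedAmplifierBlowupAlternative

open Literature.Analysis.FunctionSpaces
open Literature.Analysis.FluidPDE
open Literature.Analysis.Calculus
open Summit.NavierStokesRegularity.NavierStokesRegularity.Theorems.ForcedAmplifierBlowupAlternativeCore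
open Summit.NavierStokesRegularity.NavierStokesRegularity.Theorems.ForcedAmplifierBlowupAlternativeNormalisation

/-- **Force normalisation.**  For a smooth divergence-free datum `u₀` and a force `f` jointly smooth on
`[0,∞) × 𝕋³`: a mean-zero datum `w₀` and a field `ū` (jointly smooth on `[0,∞) × 𝕋³`, divergence-free and
mean-zero slices) such that every classical solution of NS_ν(∂ₜū) on `[0,T] × 𝕋³` from `w₀` produces a
classical solution of NS_ν(f) on `[0,T] × 𝕋³` from `u₀`.
[cite: Tao2013Localisation, §1 (normalisations of the periodic problem); MajdaBertozzi2002, §1.2 (Galilean invariance)] -/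
theorem solution_of_normalised_solution {ν T : ℝ} (hT : 0 < T) {u₀ : UnitAddTorus (Fin 3) → EuclideanSpace ℝ (Fin 3)} (hu₀ : Torus.IsSmooth u₀)
    (hu₀div : Torus.IsDivFree u₀) {f : ℝ → UnitAddTorus (Fin 3) → EuclideanSpace ℝ (Fin 3)} (hf : Torus.IsSmoothSpaceTimeOn (Ici 0) f) :
    ∃ (w₀ : UnitAddTorus (Fin 3) → EuclideanSpace ℝ (Fin 3)) (ū : ℝ → UnitAddTorus (Fin 3) → EuclideanSpace ℝ (Fin 3)), Torus.IsSmooth w₀ ∧ Torus.IsDivFree w₀ ∧ Torus.HasZeroMean w₀ ∧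
      Torus.IsSmoothSpaceTimeOn (Ici 0) ū ∧ (∀ t ∈ Ici (0 : ℝ), Torus.IsDivFree (ū t)) ∧
      (∀ t ∈ Ici (0 : ℝ), Torus.HasZeroMean (ū t)) ∧
      ∀ (w : ℝ → UnitAddTorus (Fin 3) → EuclideanSpace ℝ (Fin 3)) (q : ℝ → UnitAddTorus (Fin 3) → ℝ),
        Torus.IsClassicalNSSolutionOn (Icc 0 T) ν (fun t x => Torus.timeDerivWithin (Ici 0) ū t x) w q →
          w 0 = w₀ → ∃ (u : ℝ → UnitAddTorus (Fin 3) → EuclideanSpace ℝ (Fin 3)) (p : ℝ → UnitAddTorus (Fin 3) → ℝ),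
            Torus.IsClassicalNSSolutionOn (Icc 0 T) ν f u p ∧ u 0 = u₀ := by
  classical
  have hU : UniqueDiffOn ℝ (Icc 0 T) := uniqueDiffOn_Icc hT
  -- Step 0: extend the force smoothly to all times (agreeing on `[0, T]`).
  obtain ⟨g, hg, hgf⟩ := exists_smooth_extension hf hT
  -- Step 1: space–time Leray–Helmholtz decomposition `g = w₁ + ∇φ`.
  obtain ⟨w₁, φ, hw₁, hφ, hw₁div, hφmean, hsum⟩ := Torus.smooth_leray_helmholtz_holds (Fin 3) g hg
  -- Step 2: split off the spatial mean `m(t)` of `w₁`.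
  set m : ℝ → EuclideanSpace ℝ (Fin 3) := fun t => ∫ x, w₁ t x with hm_def
  have hm : ContDiff ℝ ∞ m :=
    contDiffOn_univ.1 (Torus.contDiffOn_integral_of_isSmoothSpaceTimeOn isOpen_univ hw₁)
  set h : ℝ → UnitAddTorus (Fin 3) → EuclideanSpace ℝ (Fin 3) := fun t x => w₁ t x - m t with hh_def
  have hh : Torus.IsSmoothSpaceTimeOn univ h :=
    hw₁.sub (Torus.isSmoothSpaceTimeOn_of_contDiffOn hm.contDiffOn)
  have hhdiv : ∀ t, Torus.IsDivFree (h t) := fun t => Torus.isDivFree_sub_const (hw₁div t) (m t)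
  have hw₁i : ∀ t, Integrable (w₁ t) := fun t => (hw₁.isSmooth_slice (mem_univ t)).integrable
  have hhmean : ∀ t, Torus.HasZeroMean (h t) := by
    intro t
    show ∫ x, (w₁ t x - m t) = 0
    rw [integral_sub (hw₁i t) (integrable_const _), integral_const, probReal_univ, one_smul]
    simp [hm_def]
  -- Step 3: the frame. `V = ∫u₀ + ∫₀ᵗ m` (the mean velocity), `ξ = -∫₀ᵗ V` (frame path).
  set V₀ : EuclideanSpace ℝ (Fin 3) := ∫ x, u₀ x with hV₀
  set V : ℝ → EuclideanSpace ℝ (Fin 3) := fun t => V₀ + prim m t with hV_def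
  have hVs : ContDiff ℝ ∞ V := contDiff_const.add (contDiff_prim hm)
  set ξ : ℝ → EuclideanSpace ℝ (Fin 3) := fun t => -prim V t with hξ_def
  have hξs : ContDiff ℝ ∞ ξ := (contDiff_prim hVs).neg
  have hξ0 : ξ 0 = 0 := by simp [hξ_def, prim_zero]
  have hdξ : deriv ξ = fun t => -V t := by
    funext t
    exact (hasDerivAt_prim hVs.continuous t).neg.deriv
  have hddξ : deriv (deriv ξ) = fun t => -m t := by
    rw [hdξ]
    funext t
    have h1 : HasDerivAt V (m t) t := (hasDerivAt_prim hm.continuous t).const_add V₀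
    exact h1.neg.deriv
  -- Step 4: the normalised force `hn(t, z) = h(t, z - ξ t)` and its time primitive `ū`.
  set hn : ℝ → UnitAddTorus (Fin 3) → EuclideanSpace ℝ (Fin 3) := fun t z => h t (z + Torus.proj (prim V t)) with hn_def
  have hhn : Torus.IsSmoothSpaceTimeOn univ hn := by
    have e := (isSmoothSpaceTimeOn_iff_torus.2 hh).comp_add_curve (contDiff_prim hVs)
    have heq : (fun t => Torus.lift (hn t)) = fun t y => Torus.lift (h t) (y + prim V t) := by
      funext t y
      simp [hn_def, Torus.lift_apply, Torus.proj_add]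
    rw [← isSmoothSpaceTimeOn_iff_torus, heq]
    exact e
  have hhndiv : ∀ t, Torus.IsDivFree (hn t) := by
    intro t x
    have hx := hhdiv t (x + Torus.proj (prim V t))
    unfold Torus.divergence at hx ⊢
    rw [← hx]
    refine Finset.sum_congr rfl fun i _ => ?_
    have e := Torus.partialDeriv_comp_add_right_sub_const i (fun y => h t y i) (Torus.proj (prim V t))
      (0 : ℝ) x
    simpa using e
  have hhnmean : ∀ t, Torus.HasZeroMean (hn t) := by
    intro t
    show ∫ z, h t (z + Torus.proj (prim V t)) = 0
    rw [integral_add_right_eq_self (fun z => h t z) (Torus.proj (prim V t))]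
    exact hhmean t
  set ū : ℝ → UnitAddTorus (Fin 3) → EuclideanSpace ℝ (Fin 3) := fun t z => ∫ s in (0 : ℝ)..t, hn s z with hū_def
  have hū : Torus.IsSmoothSpaceTimeOn univ ū := isSmoothSpaceTimeOn_timePrimitive hhn
  have hūdiv : ∀ t, Torus.IsDivFree (ū t) := fun t => isDivFree_timePrimitive hhn hhndiv t
  have hūmean : ∀ t, Torus.HasZeroMean (ū t) := fun t => hasZeroMean_timePrimitive hhn hhnmean t
  have hūt : ∀ t ∈ Icc 0 T, (fun x => Torus.timeDerivWithin (Ici 0) ū t x) = hn t := fun t ht =>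
    timeDerivWithin_timePrimitive hhn (uniqueDiffOn_Ici 0 t ht.1)
  -- Step 5: the normalised solution from the hypothesis.
  set w₀ : UnitAddTorus (Fin 3) → EuclideanSpace ℝ (Fin 3) := fun x => u₀ x - V₀ with hw₀_def
  have hw₀mean : Torus.HasZeroMean w₀ := by
    show ∫ x, (u₀ x - V₀) = 0
    rw [integral_sub hu₀.integrable (integrable_const _), integral_const, probReal_univ, one_smul]
    simp [hV₀]
  refine ⟨w₀, ū, Torus.isSmooth_sub_const hu₀ V₀, Torus.isDivFree_sub_const hu₀div V₀, hw₀mean,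
    hū.mono (subset_univ _), fun t _ => hūdiv t, fun t _ => hūmean t, fun w q hwq hw0 => ?_⟩
  have hwq' : Torus.IsClassicalNSSolutionOn (Icc 0 T) ν hn w q := classicalNS_force_congr hwq hūt
  -- Step 6: lift to `ℝ³`, pass to the accelerated frame, fix the gauge, descend.
  have hE := IsClassicalNSSolutionOn.of_torus_holds hwq'
  have hB := hE.galileanBoost hU hξs (contDiff_const (c := (0 : ℝ)))
  set u : ℝ → UnitAddTorus (Fin 3) → EuclideanSpace ℝ (Fin 3) := fun t x => w t (x + Torus.proj (ξ t)) - deriv ξ t with hu_def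
  set p : ℝ → UnitAddTorus (Fin 3) → ℝ := fun t x => q t (x + Torus.proj (ξ t)) + φ t x with hp_def
  have hUeq : (fun t => Torus.lift (u t)) = fun t y => Torus.lift (w t) (y + ξ t) - deriv ξ t := by
    funext t y
    simp [hu_def, Torus.lift_apply, Torus.proj_add]
  have hPeq : (fun t => Torus.lift (p t)) =
      fun t y => Torus.lift (q t) (y + ξ t) + Torus.lift (φ t) y := by
    funext t y
    simp [hp_def, Torus.lift_apply, Torus.proj_add]
  have hPs : IsSmoothSpaceTimeOn (Icc 0 T) (fun t => Torus.lift (p t)) := by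
    rw [hPeq]
    exact (hE.smooth_pressure.comp_add_curve hξs).add
      (isSmoothSpaceTimeOn_iff_torus.2 (hφ.mono (subset_univ _)))
  have hgauge : ∀ t ∈ Icc 0 T, ∀ y : EuclideanSpace ℝ (Fin 3),
      -gradient (Torus.lift (p t)) y + Torus.lift (f t) y =
        -gradient (fun z => Torus.lift (q t) (z + ξ t) + ⟪deriv (deriv ξ) t, z⟫ - (fun _ : ℝ => (0 : ℝ)) t) y
          + Torus.lift (hn t) (y + ξ t) := by
    intro t ht y
    have hq1 : Differentiable ℝ (Torus.lift (q t)) := (hE.contDiff_pressure ht).differentiable (by simp)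
    have hφ1 : Differentiable ℝ (Torus.lift (φ t)) := by
      have hs : ContDiff ℝ ∞ (Torus.lift (φ t)) := hφ.isSmooth_slice (mem_univ t)
      exact hs.differentiable (by simp)
    have hG1 : gradient (fun z => Torus.lift (q t) (z + ξ t) + ⟪deriv (deriv ξ) t, z⟫ -
        (fun _ : ℝ => (0 : ℝ)) t) y = gradient (Torus.lift (q t)) (y + ξ t) + deriv (deriv ξ) t :=
      gradient_comp_add_right_add_inner_sub_const hq1 (ξ t) (deriv (deriv ξ) t) _ y
    have hG2 : gradient (Torus.lift (p t)) y =
        gradient (Torus.lift (q t)) (y + ξ t) + gradient (Torus.lift (φ t)) y := by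
      have e1 : Torus.lift (p t) = fun z => Torus.lift (q t) (z + ξ t) + Torus.lift (φ t) z := by
        funext z
        simp [hp_def, Torus.lift_apply, Torus.proj_add]
      rw [e1]
      have h1 : HasFDerivAt (fun z => Torus.lift (q t) (z + ξ t)) (fderiv ℝ (Torus.lift (q t)) (y + ξ t)) y := by
        have := ((hq1 (y + ξ t)).hasFDerivAt).comp y ((hasFDerivAt_id y).add_const (ξ t))
        simpa [Function.comp_def] using this
      have h2 : HasFDerivAt (Torus.lift (φ t)) (fderiv ℝ (Torus.lift (φ t)) y) y := (hφ1 y).hasFDerivAt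
      have h3 : HasFDerivAt (fun z => Torus.lift (q t) (z + ξ t) + Torus.lift (φ t) z)
          (fderiv ℝ (Torus.lift (q t)) (y + ξ t) + fderiv ℝ (Torus.lift (φ t)) y) y := h1.add h2
      unfold gradient
      rw [h3.fderiv, map_add]
    have hf1 : Torus.lift (f t) y = Torus.lift (h t) y + m t + gradient (Torus.lift (φ t)) y := by
      rw [← hgf t ht, Torus.lift_apply, Torus.lift_apply, hsum t (Torus.proj y), Torus.gradient_lift]
      simp [hh_def]
    have hf2 : Torus.lift (hn t) (y + ξ t) = Torus.lift (h t) y := by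
      simp only [Torus.lift_apply, hn_def, ← Torus.proj_add, hξ_def, neg_add_cancel_right]
    rw [hG1, hG2, hf1, hf2, hddξ]
    beta_reduce
    simp only [neg_add_rev, neg_neg]
    abel
  have hsol : IsClassicalNSSolutionOn (Icc 0 T) ν (fun t => Torus.lift (f t)) (fun t => Torus.lift (u t))
      (fun t => Torus.lift (p t)) := by
    rw [hUeq]
    exact gauge_congr hB hPs hgauge
  refine ⟨u, p, IsClassicalNSSolutionOn.to_torus_holds hsol, ?_⟩
  funext x
  simp [hu_def, hξ0, Torus.proj_zero, hdξ, hV_def, prim_zero, hw0, hw₀_def]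


/-- **Aside `BlowupAlternative` (item stmt-NavierStokesRegularity-28106) — PROVED, by name.**  For every
`ν > 0`: if Tao's Conjecture 1.8 (torus form) fails at viscosity `ν`, then smooth forced episodes at
viscosity `ν` of one data size and horizon reach arbitrarily large `H¹` norm.
[cite: ConstantinFoias1988, Ch. 10 pp. 54–55; Tao2013Localisation, Thm 5.1 + Lemma 5.2 + Remark 1.11] -/
theorem blowupAlternative_proof : Summit.NavierStokesRegularity.NavierStokesRegularity.Theses.ForcedAmplifier.BlowupAlternative := by
  intro ν hν hnot
  push Not at hnot
  obtain ⟨T, hT, u₀, hu₀, hu₀div, f, hf, hno⟩ := hnot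
  obtain ⟨w₀, ū, hw₀, hw₀div, hw₀mean, hū, hūdiv, hūmean, hsolve⟩ :=
    solution_of_normalised_solution (ν := ν) hT hu₀ hu₀div hf
  exact amplification_of_noncontinuable hν hT hw₀ hw₀div hw₀mean hū hūdiv hūmean fun w q h => by
    obtain ⟨u, p, hu, hu0⟩ := hsolve w q h.1 h.2
    exact hno u p hu hu0

end Summit.NavierStokesRegularity.NavierStokesRegularity.Theorems.ForcedAmplifierBlowupAlternative

end
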